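import Summits.Ventures.LatticeQCDFlow.Scoring.NonabelianAreaLaw2DPeelRect
import Summits.Ventures.LatticeQCDFlow.Scoring.NonabelianAreaLaw2DOpenWilsonLoop
import HarnessLib

/-!
# The exact non-abelian area law in two dimensions, IV-c: a Wilson loop ANYWHERE inside an open rectangle

HONEST FRAMING: exact (Metropolis-corrected) sampling algorithms for lattice gauge theory;
figures of merit are autocorrelation/cost numbers at stated couplings and volumes; no
continuum-physics claim.

Venture `LatticeQCDFlow` (cell pub-lqcd), sub-topic `Scoring`; FANOUT row 5 (`s0-sun-a`), GEN-18.
NEW WORK of the cell (placement rule).  The genuine free-boundary Wilson theory on an open `R₀ × T₀` lattice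
(realised in `(ℤ/L)²` with corner `(i, j)`, `R₀ + 1 ≤ L`, `T₀ + 1 ≤ L`; weights `∏_{p∈B} w(U_p)` on its
plaquettes, all links Haar) and an `R × T` loop ANYWHERE inside it (corner `(i + a₀, j + b₀)`, `a₀ + R ≤ R₀`,
`b₀ + T ≤ T₀`), for every compact second-countable gauge group `G`, continuous representation `ρ`, continuous
class weight `w`, `M = ∫ ρ(g) w(g) dg`:

* **`integral_rep_loop_mul_prod_weight_rect`** — THE MATRIX AREA LAW FOR AN INTERIOR LOOP:
  `∫ ρ(W)_{ab} ∏_{p∈B} w(U_p) dHaar^{⊗E} = (∫w)^{R₀T₀−RT} · (M^{RT})_{ab}` (the loop ignores the private links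
  of the four outer strips — part IV-b peels them — and part II evaluates the loop on its own interior);
* **`interiorWilsonLoop_eq_re_pow_of_scalar`** — for scalar `M = c·1` and `∫ w ≠ 0`, the tree's
  `wilsonLoop ρ = N⁻¹ Re tr ρ(W)` obeys `⟨W_{R×T}⟩_{B,w} = Re((c/∫w)^{RT})` for EVERY position of the loop and
  every lattice size — free boundary conditions break translation invariance, the Wilson loop does not notice;
  no perimeter or finite-size correction;
* **`unitary_interiorWilsonLoop_eq_plaquette_pow`**, **`specialUnitary_interiorWilsonLoop_eq_plaquette_pow`**
  — `U(N)` and `SU(N)`, every `N ≥ 1`, every real `β`, theory-2's conventions (`wilsonLoop`, weight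
  `e^{−β(N − Re tr U_p)}`): `⟨W_{R×T}⟩_{open R₀×T₀, β} = P_N(β)^{RT}` with the one-plaquette plaquette
  `P_N(β) = ∫ (Re tr u/N) e^{−β(N−Re tr u)} du / ∫ e^{−β(N−Re tr u)} du` (closed Bessel forms: GEN-17) — the
  general-`N`, general-position form of GEN-12's `SU2OpenRectangleWilsonLoops.open_wilson_mean_su2a0_loop_two`.

Published forms: Gross–Witten 1980 §II; Balian–Drouffe–Itzykson 1975; Migdal 1975.  No `def`, nothing cited
as a fact, 0 sorry.
-/

noncomputable section

open MeasureTheory Function Finset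
open Literature.MathematicalPhysics.QuantumFieldTheory
open Literature.MathematicalPhysics.QuantumLattice
open Summit.Ventures.LatticeQCDFlow.Theory2.Lattice
open Summit.Ventures.LatticeQCDFlow.Theory2.Lattice.TwoDim

namespace Summit.Ventures.LatticeQCDFlow.Scoring

variable {L : ℕ} [NeZero L] {G : Type*} [Group G] [TopologicalSpace G] [IsTopologicalGroup G]
  [CompactSpace G] [SecondCountableTopology G] [MeasurableSpace G] [BorelSpace G]

/-! ## §4. A loop anywhere inside an open rectangle -/

section Interior

/-- **THE MATRIX AREA LAW FOR AN INTERIOR LOOP.**  For every compact gauge group, continuous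
representation `ρ`, continuous class weight `w`: on the open `R₀ × T₀` lattice with corner `(i, j)`
(realised in `(ℤ/L)²`, `R₀ + 1 ≤ L`, `T₀ + 1 ≤ L`), the `R × T` loop with corner `(i + a₀, j + b₀)`,
`a₀ + R ≤ R₀`, `b₀ + T ≤ T₀`, satisfies
`∫ ρ(W)_{ab} ∏_{p ∈ R₀×T₀} w(U_p) dHaar^{⊗E} = (∫w)^{R₀T₀ − RT} · (M^{RT})_{ab}`, `M = ∫ ρ(g) w(g) dg`. -/
theorem integral_rep_loop_mul_prod_weight_rect {N : ℕ} (ρ : G →* Matrix (Fin N) (Fin N) ℂ)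
    (hρ : Continuous ρ) {w : G → ℝ} (hw : Continuous w) (hwc : ∀ k g, w (k * g * k⁻¹) = w g)
    (i j : ZMod L) {R₀ T₀ a₀ b₀ R T : ℕ} (hR₀ : R₀ + 1 ≤ L) (hT₀ : T₀ + 1 ≤ L) (ha : a₀ + R ≤ R₀)
    (hb : b₀ + T ≤ T₀) (a b : Fin N) :
    ∫ U, ρ (rectangleHolonomy U ![i + a₀, j + b₀] 0 1 R T) a b *
        ∏ p ∈ (range R₀ ×ˢ range T₀).image (fun q : ℕ × ℕ => (![i + q.1, j + q.2] : Site 2 L)),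
          (w (plaquetteHolonomy U p 0 1) : ℂ) ∂(Measure.pi fun _ : Edge 2 L => haarProbability G) =
      (∫ g, (w g : ℂ) ∂(haarProbability G)) ^ (R₀ * T₀ - R * T) *
        ((Matrix.of fun k l : Fin N => ∫ g, ρ g k l * (w g : ℂ) ∂(haarProbability G)) ^ (R * T)) a b := by
  have hΦ : Continuous fun U : GaugeConfig 2 L G => ρ (rectangleHolonomy U ![i + a₀, j + b₀] 0 1 R T) a b :=
    (hρ.comp (continuous_config_rectangleHolonomy _ 0 1 R T)).matrix_elem a b
  -- the loop ignores the vertical links of the columns `≠ a₀, a₀ + R` and the horizontal links of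
  -- the rows `≠ b₀, b₀ + T`
  have hcol : ∀ (c' : ℕ) (y : ZMod L) (U : GaugeConfig 2 L G) (g : G), c' < L → c' ≠ a₀ → c' ≠ a₀ + R →
      ρ (rectangleHolonomy (update U ((![i + c', y], 1) : Edge 2 L) g) ![i + a₀, j + b₀] 0 1 R T) a b =
        ρ (rectangleHolonomy U ![i + a₀, j + b₀] 0 1 R T) a b := by
    intro c' y U g hc' h1 h2
    rw [rectangleHolonomy_update_col (L := L) (i + a₀) (j + b₀) R T (x' := i + c')
      (fun h => natCast_zmod_ne_of_lt (L := L) (j := a₀) (k := c') (by omega) hc' (Ne.symm h1)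
        (add_left_cancel h))
      (fun h => natCast_zmod_ne_of_lt (L := L) (j := a₀ + R) (k := c') (by omega) hc' (Ne.symm h2) (by
        rw [add_assoc] at h
        push_cast
        exact add_left_cancel h))]
  have hrow : ∀ (r : ℕ) (x : ZMod L) (U : GaugeConfig 2 L G) (g : G), r < L → r ≠ b₀ → r ≠ b₀ + T →
      ρ (rectangleHolonomy (update U ((![x, j + r], 0) : Edge 2 L) g) ![i + a₀, j + b₀] 0 1 R T) a b =
        ρ (rectangleHolonomy U ![i + a₀, j + b₀] 0 1 R T) a b := by
    intro r x U g hr h1 h2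
    rw [rectangleHolonomy_update_row (L := L) (i + a₀) (j + b₀) R T (y' := j + r)
      (fun h => natCast_zmod_ne_of_lt (L := L) (j := b₀) (k := r) (by omega) hr (Ne.symm h1)
        (add_left_cancel h))
      (fun h => natCast_zmod_ne_of_lt (L := L) (j := b₀ + T) (k := r) (by omega) hr (Ne.symm h2) (by
        rw [add_assoc] at h
        push_cast
        exact add_left_cancel h))]
  -- (i) right columns, (ii) left columns, (iii) top rows, (iv) bottom rows
  rw [integral_mul_prod_rect_peel_right hw hΦ i j (c := a₀ + R) hT₀
      (fun c' y U g hc' hc'L => hcol c' y U g (by omega) (by omega) (by omega)) R₀ ha hR₀,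
    integral_mul_prod_rect_peel_left hw hΦ j hT₀ a₀ i (R' := R) (by omega)
      (fun c' y U g hc' => hcol c' y U g (by omega) (by omega) (by omega)),
    integral_mul_prod_rect_peel_top hw hΦ (i + a₀) j (R := R) (c := b₀ + T) (by omega)
      (fun r x U g hr hrL => hrow r x U g (by omega) (by omega) (by omega)) T₀ hb hT₀,
    integral_mul_prod_rect_peel_bottom hw hΦ (i + a₀) (R := R) (by omega) b₀ j (T' := T) (by omega)
      (fun r x U g hr => hrow r x U g (by omega) (by omega) (by omega)),
    integral_rep_rectangleHolonomy_mul_prod_weight (L := L) ρ hρ hw hwc (i + a₀) (j + b₀) (by omega) (by omega),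
    ← mul_assoc, ← mul_assoc, ← mul_assoc, ← pow_add, ← pow_add, ← pow_add]
  congr 2
  obtain ⟨X, rfl⟩ : ∃ X, R₀ = X + (a₀ + R) := ⟨R₀ - (a₀ + R), by omega⟩
  obtain ⟨Y, rfl⟩ : ∃ Y, T₀ = Y + (b₀ + T) := ⟨T₀ - (b₀ + T), by omega⟩
  rw [Nat.add_sub_cancel, Nat.add_sub_cancel]
  refine Nat.eq_sub_of_add_eq ?_
  ring

/-- **THE EXACT AREA LAW FOR A LOOP ANYWHERE IN THE OPEN LATTICE** (scalar one-plaquette matrix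
`M = c·1`, `∫ w ≠ 0`): `⟨N⁻¹ Re tr ρ(W_{R×T})⟩_{open R₀×T₀, w} = Re((c/∫w)^{RT})` — independent of the
position `(a₀, b₀)` of the loop and of the lattice size: free boundary conditions break translation
invariance, the Wilson loop does not notice. -/
theorem interiorWilsonLoop_eq_re_pow_of_scalar {N : ℕ} [NeZero N] (ρ : G →* Matrix (Fin N) (Fin N) ℂ)
    (hρ : Continuous ρ) {w : G → ℝ} (hw : Continuous w) (hwc : ∀ k g, w (k * g * k⁻¹) = w g)
    (hw0 : ∫ g, w g ∂(haarProbability G) ≠ 0) {c : ℂ}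
    (hM : (Matrix.of fun k l : Fin N => ∫ g, ρ g k l * (w g : ℂ) ∂(haarProbability G)) =
      c • (1 : Matrix (Fin N) (Fin N) ℂ))
    (i j : ZMod L) {R₀ T₀ a₀ b₀ R T : ℕ} (hR₀ : R₀ + 1 ≤ L) (hT₀ : T₀ + 1 ≤ L) (ha : a₀ + R ≤ R₀)
    (hb : b₀ + T ≤ T₀) :
    (∫ U, wilsonLoop ρ (![i + a₀, j + b₀] : Site 2 L) 0 1 R T U *
          ∏ p ∈ (range R₀ ×ˢ range T₀).image (fun q : ℕ × ℕ => (![i + q.1, j + q.2] : Site 2 L)),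
            w (plaquetteHolonomy U p 0 1) ∂(Measure.pi fun _ : Edge 2 L => haarProbability G)) /
        ∫ U, ∏ p ∈ (range R₀ ×ˢ range T₀).image (fun q : ℕ × ℕ => (![i + q.1, j + q.2] : Site 2 L)),
          w (plaquetteHolonomy U p 0 1) ∂(Measure.pi fun _ : Edge 2 L => haarProbability G) =
      ((c / (∫ g, w g ∂(haarProbability G) : ℝ)) ^ (R * T)).re := by
  -- numerator: `N⁻¹ Re Σ_a ∫ ρ(W)_{aa} ∏ w = (∫w)^{R₀T₀−RT} Re(c^{RT})`
  have hF : ∀ U : GaugeConfig 2 L G,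
      wilsonLoop ρ (![i + a₀, j + b₀] : Site 2 L) 0 1 R T U *
          ∏ p ∈ (range R₀ ×ˢ range T₀).image (fun q : ℕ × ℕ => (![i + q.1, j + q.2] : Site 2 L)),
            w (plaquetteHolonomy U p 0 1) =
        (N : ℝ)⁻¹ * (∑ a, ρ (rectangleHolonomy U ![i + a₀, j + b₀] 0 1 R T) a a *
          ∏ p ∈ (range R₀ ×ˢ range T₀).image (fun q : ℕ × ℕ => (![i + q.1, j + q.2] : Site 2 L)),
            (w (plaquetteHolonomy U p 0 1) : ℂ)).re := by
    intro U
    rw [wilsonLoop, mul_assoc]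
    congr 1
    rw [← Finset.sum_mul, ← Complex.ofReal_prod, Complex.mul_re, Complex.ofReal_re, Complex.ofReal_im,
      mul_zero, sub_zero]
    rfl
  have hint : ∀ a : Fin N, Integrable (fun U : GaugeConfig 2 L G =>
      ρ (rectangleHolonomy U ![i + a₀, j + b₀] 0 1 R T) a a *
        ∏ p ∈ (range R₀ ×ˢ range T₀).image (fun q : ℕ × ℕ => (![i + q.1, j + q.2] : Site 2 L)),
          (w (plaquetteHolonomy U p 0 1) : ℂ))
      (Measure.pi fun _ : Edge 2 L => haarProbability G) := fun a =>
    integrable_gaugeConfig_of_continuous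
      (((hρ.comp (continuous_config_rectangleHolonomy _ 0 1 R T)).matrix_elem a a).mul
        (continuous_finsetProd _ fun p _ =>
          Complex.continuous_ofReal.comp (hw.comp (continuous_config_plaquetteHolonomy p 0 1))))
  have hterm : ∀ a : Fin N,
      ∫ U, ρ (rectangleHolonomy U ![i + a₀, j + b₀] 0 1 R T) a a *
          ∏ p ∈ (range R₀ ×ˢ range T₀).image (fun q : ℕ × ℕ => (![i + q.1, j + q.2] : Site 2 L)),
            (w (plaquetteHolonomy U p 0 1) : ℂ) ∂(Measure.pi fun _ : Edge 2 L => haarProbability G) =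
        (∫ g, (w g : ℂ) ∂(haarProbability G)) ^ (R₀ * T₀ - R * T) * c ^ (R * T) := by
    intro a
    rw [integral_rep_loop_mul_prod_weight_rect ρ hρ hw hwc i j hR₀ hT₀ ha hb, hM, smul_pow, one_pow,
      Matrix.smul_apply, Matrix.one_apply_eq, smul_eq_mul, mul_one]
  have hre : ∫ U, (∑ a, ρ (rectangleHolonomy U ![i + a₀, j + b₀] 0 1 R T) a a *
        ∏ p ∈ (range R₀ ×ˢ range T₀).image (fun q : ℕ × ℕ => (![i + q.1, j + q.2] : Site 2 L)),
          (w (plaquetteHolonomy U p 0 1) : ℂ)).re ∂(Measure.pi fun _ : Edge 2 L => haarProbability G) =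
      (∫ U, ∑ a, ρ (rectangleHolonomy U ![i + a₀, j + b₀] 0 1 R T) a a *
        ∏ p ∈ (range R₀ ×ˢ range T₀).image (fun q : ℕ × ℕ => (![i + q.1, j + q.2] : Site 2 L)),
          (w (plaquetteHolonomy U p 0 1) : ℂ) ∂(Measure.pi fun _ : Edge 2 L => haarProbability G)).re := by
    simpa only [RCLike.re_to_complex] using integral_re (integrable_finsetSum _ fun a _ => hint a)
  simp_rw [hF]
  rw [integral_const_mul, hre, integral_finsetSum _ fun a _ => hint a]
  simp only [hterm, Finset.sum_const, Finset.card_univ, Fintype.card_fin, nsmul_eq_mul]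
  rw [← Complex.ofReal_natCast, Complex.re_ofReal_mul, ← mul_assoc,
    inv_mul_cancel₀ (Nat.cast_ne_zero.mpr (NeZero.ne N)), one_mul, integral_complex_ofReal,
    ← Complex.ofReal_pow, Complex.re_ofReal_mul, integral_prod_weight_rect hw hwc i j hR₀ hT₀, div_pow,
    ← Complex.ofReal_pow, Complex.div_ofReal_re]
  -- `(∫w)^{R₀T₀−RT} Re(c^{RT}) / (∫w)^{R₀T₀} = Re(c^{RT}) / (∫w)^{RT}`
  have hRT : R * T ≤ R₀ * T₀ := Nat.mul_le_mul (by omega) (by omega)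
  obtain ⟨e, he⟩ : ∃ e, R₀ * T₀ = e + R * T := ⟨R₀ * T₀ - R * T, by omega⟩
  rw [he, Nat.add_sub_cancel, pow_add, mul_div_mul_left _ _ (pow_ne_zero _ hw0)]

/-- **`U(N)`: THE WILSON LOOP ANYWHERE IN THE OPEN LATTICE, EVERY `N ≥ 1`, EVERY REAL `β`** (theory-2's
conventions): on the open `R₀ × T₀` lattice with the Wilson weight `e^{−β(N − Re tr U_p)}` per plaquette,
`⟨W_{R×T}⟩ = P_N(β)^{RT}` for every position of the loop, `P_N(β) = ∫ (Re tr u/N) e^{−β(N − Re tr u)} du /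
∫ e^{−β(N − Re tr u)} du` the one-plaquette plaquette (`= N⁻¹(log det[I_{|i−j|}])′(β)`, GEN-17). -/
theorem unitary_interiorWilsonLoop_eq_plaquette_pow (N : ℕ) [NeZero N] (β : ℝ) (i j : ZMod L)
    {R₀ T₀ a₀ b₀ R T : ℕ} (hR₀ : R₀ + 1 ≤ L) (hT₀ : T₀ + 1 ≤ L) (ha : a₀ + R ≤ R₀) (hb : b₀ + T ≤ T₀) :
    (∫ U, wilsonLoop (unitaryFundamentalRep (Fin N) ℂ) (![i + a₀, j + b₀] : Site 2 L) 0 1 R T U *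
          ∏ p ∈ (range R₀ ×ˢ range T₀).image (fun q : ℕ × ℕ => (![i + q.1, j + q.2] : Site 2 L)),
            Real.exp (-(β * ((N : ℝ) - ((plaquetteHolonomy U p 0 1 : Matrix.unitaryGroup (Fin N) ℂ) :
              Matrix (Fin N) (Fin N) ℂ).trace.re)))
          ∂(Measure.pi fun _ : Edge 2 L => haarProbability (Matrix.unitaryGroup (Fin N) ℂ))) /
        ∫ U, ∏ p ∈ (range R₀ ×ˢ range T₀).image (fun q : ℕ × ℕ => (![i + q.1, j + q.2] : Site 2 L)),
            Real.exp (-(β * ((N : ℝ) - ((plaquetteHolonomy U p 0 1 : Matrix.unitaryGroup (Fin N) ℂ) :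
              Matrix (Fin N) (Fin N) ℂ).trace.re)))
          ∂(Measure.pi fun _ : Edge 2 L => haarProbability (Matrix.unitaryGroup (Fin N) ℂ)) =
      ((∫ u, ((u : Matrix.unitaryGroup (Fin N) ℂ) : Matrix (Fin N) (Fin N) ℂ).trace.re / N *
            Real.exp (-(β * ((N : ℝ) - ((u : Matrix.unitaryGroup (Fin N) ℂ) : Matrix (Fin N) (Fin N) ℂ).trace.re)))
          ∂(haarProbability (Matrix.unitaryGroup (Fin N) ℂ))) /
        (∫ u, Real.exp (-(β * ((N : ℝ) - ((u : Matrix.unitaryGroup (Fin N) ℂ) : Matrix (Fin N) (Fin N) ℂ).trace.re)))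
          ∂(haarProbability (Matrix.unitaryGroup (Fin N) ℂ)))) ^ (R * T) := by
  have hF : Continuous fun x : ℝ => Real.exp (-(β * ((N : ℝ) - x))) := by fun_prop
  have hw : Continuous fun u : Matrix.unitaryGroup (Fin N) ℂ =>
      Real.exp (-(β * ((N : ℝ) - ((u : Matrix.unitaryGroup (Fin N) ℂ) : Matrix (Fin N) (Fin N) ℂ).trace.re))) := by
    fun_prop
  have hw0 : ∫ u, Real.exp (-(β * ((N : ℝ) -
      ((u : Matrix.unitaryGroup (Fin N) ℂ) : Matrix (Fin N) (Fin N) ℂ).trace.re)))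
        ∂(haarProbability (Matrix.unitaryGroup (Fin N) ℂ)) ≠ 0 :=
    (integral_exp_pos (integrable_haarProbability_of_continuous hw)).ne'
  have hM : (Matrix.of fun k l : Fin N => ∫ u, (unitaryFundamentalRep (Fin N) ℂ) u k l *
      (Real.exp (-(β * ((N : ℝ) - ((u : Matrix.unitaryGroup (Fin N) ℂ) : Matrix (Fin N) (Fin N) ℂ).trace.re))) : ℂ)
        ∂(haarProbability (Matrix.unitaryGroup (Fin N) ℂ))) =
      (((N : ℝ)⁻¹ * ∫ u, ((u : Matrix.unitaryGroup (Fin N) ℂ) : Matrix (Fin N) (Fin N) ℂ).trace.re *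
          Real.exp (-(β * ((N : ℝ) - ((u : Matrix.unitaryGroup (Fin N) ℂ) : Matrix (Fin N) (Fin N) ℂ).trace.re)))
          ∂(haarProbability (Matrix.unitaryGroup (Fin N) ℂ)) : ℝ) : ℂ) • (1 : Matrix (Fin N) (Fin N) ℂ) := by
    simp only [unitaryFundamentalRep_apply]
    exact unitary_integralMatrix_eq_smul_one N hF
  rw [interiorWilsonLoop_eq_re_pow_of_scalar (unitaryFundamentalRep (Fin N) ℂ)
    (continuous_unitaryFundamentalRep (Fin N) ℂ) hw (unitary_wilsonWeight_conj N β) hw0 hM i j hR₀ hT₀ ha hb,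
    ← Complex.ofReal_div, ← Complex.ofReal_pow, Complex.ofReal_re, ← integral_const_mul]
  congr 3
  funext u
  ring

/-- **`SU(N)`: THE WILSON LOOP ANYWHERE IN THE OPEN LATTICE, EVERY `N ≥ 1`, EVERY REAL `β`**:
`⟨W_{R×T}⟩_{open R₀×T₀, β} = P_N(β)^{RT}` with the `SU(N)` one-plaquette plaquette `P_N(β)` (GEN-17's Bessel
forms; `N = 2`: `I₂(2β)/I₁(2β)` — GEN-12's `open_wilson_mean_su2a0_loop_two` by characters, now for every `N`). -/
theorem specialUnitary_interiorWilsonLoop_eq_plaquette_pow (N : ℕ) [NeZero N] (β : ℝ) (i j : ZMod L)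
    {R₀ T₀ a₀ b₀ R T : ℕ} (hR₀ : R₀ + 1 ≤ L) (hT₀ : T₀ + 1 ≤ L) (ha : a₀ + R ≤ R₀) (hb : b₀ + T ≤ T₀) :
    (∫ U, wilsonLoop (fundamentalRep (Fin N)) (![i + a₀, j + b₀] : Site 2 L) 0 1 R T U *
          ∏ p ∈ (range R₀ ×ˢ range T₀).image (fun q : ℕ × ℕ => (![i + q.1, j + q.2] : Site 2 L)),
            Real.exp (-(β * ((N : ℝ) - ((plaquetteHolonomy U p 0 1 : Matrix.specialUnitaryGroup (Fin N) ℂ) :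
              Matrix (Fin N) (Fin N) ℂ).trace.re)))
          ∂(Measure.pi fun _ : Edge 2 L => haarProbability (Matrix.specialUnitaryGroup (Fin N) ℂ))) /
        ∫ U, ∏ p ∈ (range R₀ ×ˢ range T₀).image (fun q : ℕ × ℕ => (![i + q.1, j + q.2] : Site 2 L)),
            Real.exp (-(β * ((N : ℝ) - ((plaquetteHolonomy U p 0 1 : Matrix.specialUnitaryGroup (Fin N) ℂ) :
              Matrix (Fin N) (Fin N) ℂ).trace.re)))
          ∂(Measure.pi fun _ : Edge 2 L => haarProbability (Matrix.specialUnitaryGroup (Fin N) ℂ)) =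
      ((∫ u, ((u : Matrix.specialUnitaryGroup (Fin N) ℂ) : Matrix (Fin N) (Fin N) ℂ).trace.re / N *
            Real.exp (-(β * ((N : ℝ) -
              ((u : Matrix.specialUnitaryGroup (Fin N) ℂ) : Matrix (Fin N) (Fin N) ℂ).trace.re)))
          ∂(haarProbability (Matrix.specialUnitaryGroup (Fin N) ℂ))) /
        (∫ u, Real.exp (-(β * ((N : ℝ) -
            ((u : Matrix.specialUnitaryGroup (Fin N) ℂ) : Matrix (Fin N) (Fin N) ℂ).trace.re)))
          ∂(haarProbability (Matrix.specialUnitaryGroup (Fin N) ℂ)))) ^ (R * T) := by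
  have hF : Continuous fun x : ℝ => Real.exp (-(β * ((N : ℝ) - x))) := by fun_prop
  have hw : Continuous fun u : Matrix.specialUnitaryGroup (Fin N) ℂ =>
      Real.exp (-(β * ((N : ℝ) -
        ((u : Matrix.specialUnitaryGroup (Fin N) ℂ) : Matrix (Fin N) (Fin N) ℂ).trace.re))) := by
    fun_prop
  have hw0 : ∫ u, Real.exp (-(β * ((N : ℝ) -
      ((u : Matrix.specialUnitaryGroup (Fin N) ℂ) : Matrix (Fin N) (Fin N) ℂ).trace.re)))
        ∂(haarProbability (Matrix.specialUnitaryGroup (Fin N) ℂ)) ≠ 0 :=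
    (integral_exp_pos (integrable_haarProbability_of_continuous hw)).ne'
  have hM : (Matrix.of fun k l : Fin N => ∫ u, (fundamentalRep (Fin N)) u k l *
      (Real.exp (-(β * ((N : ℝ) -
        ((u : Matrix.specialUnitaryGroup (Fin N) ℂ) : Matrix (Fin N) (Fin N) ℂ).trace.re))) : ℂ)
        ∂(haarProbability (Matrix.specialUnitaryGroup (Fin N) ℂ))) =
      (((N : ℝ)⁻¹ * ∫ u, ((u : Matrix.specialUnitaryGroup (Fin N) ℂ) : Matrix (Fin N) (Fin N) ℂ).trace.re *
          Real.exp (-(β * ((N : ℝ) -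
            ((u : Matrix.specialUnitaryGroup (Fin N) ℂ) : Matrix (Fin N) (Fin N) ℂ).trace.re)))
          ∂(haarProbability (Matrix.specialUnitaryGroup (Fin N) ℂ)) : ℝ) : ℂ) •
        (1 : Matrix (Fin N) (Fin N) ℂ) := by
    simp only [fundamentalRep_apply]
    exact specialUnitary_integralMatrix_eq_smul_one N hF
  rw [interiorWilsonLoop_eq_re_pow_of_scalar (fundamentalRep (Fin N)) (continuous_fundamentalRep (Fin N)) hw
    (specialUnitary_wilsonWeight_conj N β) hw0 hM i j hR₀ hT₀ ha hb,
    ← Complex.ofReal_div, ← Complex.ofReal_pow, Complex.ofReal_re, ← integral_const_mul]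
  congr 3
  funext u
  ring

end Interior

end Summit.Ventures.LatticeQCDFlow.Scoring
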